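import Summits.PneNP.PneNP.Theorems.PhaseTwinsPolyDepthTwinsAboveAcConnectorDecomp

/-!
# Route PhaseTwins, crux `PolyDepthTwinsAbove` (stmt-PneNP-2719), line `annealed-cover-twins`:
# `stub_annealedConnector`, part 2 — the pattern sum under the mixture of product laws

The port computation of Sly's Lemma 2.2 for the cover wiring. With the effective gadget factors `acGG δ`
of part 1 (`…AcConnectorDecomp`) replaced by their main terms — `mixLaw k · gadTot` at a canonical dart
(the annealed port law of the line), the junk factor `|GSample| · junkG k` itself at a non-canonical one —
the pattern sum evaluates EXACTLY to `C₁ · A_c` (`sum_prod_mid_mul_acWc`), `A_c = acA … c` the Tseitin-type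
sum of the line and `C₁ = 2^{-3M} · Π_δ mass_δ · (1+λ)^{10Mκ}` charge-independent (mass `gadTot` at a
canonical dart, `|GSample| (1+λ)^{2n'}` on the junk):

* `junkG_eq` — the junk factor is `(1+λ)^{2n'}` times a PRODUCT law (occupation probability `λ/(1+λ)`):
  an edgeless fibre is a product measure (marginalisation `sum_bw_marginal` onto the port vertices);
* `mid_eq_sum` — hence every substituted factor is the average over a phase bit of a product law on the
  `4κ` port coordinates of its gadget (`mixLaw` is by definition the average of the two `prodLaw`s), and the
  product over the darts is `2^{-3M} Π_δ mass_δ · Σ_{Y : Dart → Bool} (product law of the pattern family)`;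
* `sum_bw_acWc` — under ANY product law on the port coordinates the expected complex factor `acWc` (local
  factors at vacancy INDICATORS) is the product of the local factors at the vacancy PROBABILITIES of the
  coordinates the ends read: these are pairwise distinct (`usedCoord_injective`, from `canonEnd_injective`
  and the injectivity of `P`), and `cxWeight` is affine in each vacancy (`sum_bw_cxWeight`,
  `sum_bw_prod_split`, `sum_bw_marginal` of the sibling line `parity-wired-ports`);
* `canon_canonEnd_fst` — on a base WITHOUT HALF-EDGES (`NoFixed`) every end reads a canonical gadget, where
  the law given `Y` is `layerOcc q⁺ q⁻ (Y δ)`, i.e. `occP q⁺ q⁻ (seen R Y w (i, a))`; the product over the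
  `κ` complexes at each `w` gives `(1+λ)^{10Mκ} Π_w cxW(c w; seen R Y w)^κ` (`prod_cxWeight_seen`).
No auxiliary definitions (the weights are written out). [cite: Sly2010, Lemma 2.2 (proof, last two
displays); folklore]
-/

noncomputable section

open scoped Classical BigOperators

namespace Summit.PneNP.PneNP.Cruxes.PolyDepthTwinsAbove.AnnealedCoverTwins

open Finset
open Summit.PneNP.PneNP.Cruxes.PolyDepthTwinsAbove.ParityWiredPorts (canonEnd canonEnd_injective occP cxWeight
  cxW sum_bw_marginal sum_bw_prod_split sum_bw_cxWeight)
open Literature.Computability.Complexity.Expander (RotGraph)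
open Literature.ModelTheory.FiniteModelTheory.TseitinColouring (Dart)
open Literature.ModelTheory.FiniteModelTheory.CFIMatching (Canon NoFixed code code_injective)

set_option linter.dupNamespace false

variable {M n' κ dm : ℕ}

/-! ## The junk fibres follow a product law with occupation probability `λ/(1+λ)` -/

/-- Port coordinates embed into the vertex set of a gadget. -/
theorem portVert_injective (P : Fin 2 × Fin κ ↪ Fin n') :
    Function.Injective (fun q : (Fin 2 × Fin κ) × ZMod 2 => ((q.2, P q.1) : ZMod 2 × Fin n')) := by
  rintro ⟨s, a⟩ ⟨s', a'⟩ h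
  simp only [Prod.mk.injEq] at h
  obtain ⟨rfl, h2⟩ := h
  rw [P.injective h2]

/-- **The junk partition function is `(1+λ)^{2n'}` times a product law** with occupation probability
`λ/(1+λ)` at every port coordinate (the vertices of a junk fibre are isolated, hence independently occupied;
marginalisation `sum_bw_marginal` onto the `4κ` port vertices). -/
theorem junkG_eq (P : Fin 2 × Fin κ ↪ Fin n') {lam : ℝ} (hlam : 0 ≤ lam) (k : PortPat κ) :
    junkG P lam k = (1 + lam) ^ Fintype.card (ZMod 2 × Fin n') *
      ∏ q : (Fin 2 × Fin κ) × ZMod 2, (if k q then lam / (1 + lam) else 1 - lam / (1 + lam)) := by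
  have h1 : (1 + lam) ≠ 0 := by positivity
  have key : ∀ a m : ℕ, (1 + lam) ^ (a + m) * ((lam / (1 + lam)) ^ a * (1 - lam / (1 + lam)) ^ m) = lam ^ a := by
    intro a m
    have h3 : 1 - lam / (1 + lam) = (1 + lam)⁻¹ := by
      rw [one_sub_div h1, add_sub_cancel_right, one_div]
    rw [h3, div_eq_mul_inv, mul_pow, inv_pow, inv_pow, mul_assoc, ← mul_inv, ← pow_add, mul_left_comm,
      mul_inv_cancel₀ (pow_ne_zero _ h1), mul_one]
  -- the product law as the Bernoulli weight of the set of occupied coordinates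
  have hprod : (∏ q : (Fin 2 × Fin κ) × ZMod 2, (if k q then lam / (1 + lam) else 1 - lam / (1 + lam))) =
      ∑ t : Finset ((Fin 2 × Fin κ) × ZMod 2), ((∏ _q ∈ t, lam / (1 + lam)) * ∏ _q ∈ tᶜ, (1 - lam / (1 + lam))) *
        (if (univ.filter fun q => k q = true) = t then 1 else 0) := by
    rw [Finset.sum_mul_boole, if_pos (mem_univ _), prod_ite, compl_filter]
  -- marginalisation from the vertex set of the gadget onto the port vertices
  have hmarg := sum_bw_marginal (fun q : (Fin 2 × Fin κ) × ZMod 2 => ((q.2, P q.1) : ZMod 2 × Fin n'))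
    (portVert_injective P) (fun _ => lam / (1 + lam))
    (fun t => if (univ.filter fun q => k q = true) = t then (1 : ℝ) else 0)
  rw [hprod, ← hmarg, mul_sum]
  unfold junkG
  refine sum_congr rfl fun J _ => ?_
  have hiff : ((univ.filter fun q : (Fin 2 × Fin κ) × ZMod 2 => k q = true) =
      univ.filter fun q : (Fin 2 × Fin κ) × ZMod 2 => (q.2, P q.1) ∈ J) ↔ gadPat P J = k := by
    rw [Finset.ext_iff, funext_iff]
    simp only [mem_filter, mem_univ, true_and, gadPat]
    refine forall_congr' fun q => ?_
    cases k q <;> simp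
  by_cases hk : gadPat P J = k
  · rw [if_pos (hiff.2 hk), if_pos hk, mul_one, prod_const, prod_const, card_compl]
    obtain ⟨m, hm⟩ := Nat.exists_eq_add_of_le (card_le_univ J)
    rw [hm, Nat.add_sub_cancel_left]
    exact (key _ _).symm
  · rw [if_neg (fun h => hk (hiff.1 h)), if_neg hk, mul_zero, mul_zero]

/-! ## The complex factor under a product law on the port coordinates -/

/-- The used port coordinates: the end `(w, i, a, j)` reads the coordinate `((s, j), a)` of the gadget
`δ`, `(δ, s) = canonEnd R (w, i)`; distinct ends read distinct coordinates (`canonEnd_injective`). -/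
theorem usedCoord_injective (R : RotGraph M 3) :
    Function.Injective (fun u : (Fin M × Fin κ) × (Fin 3 × ZMod 2) =>
      (((canonEnd R (u.1.1, u.2.1)).1, (((canonEnd R (u.1.1, u.2.1)).2, u.1.2), u.2.2)) :
        Dart M 3 × ((Fin 2 × Fin κ) × ZMod 2))) := by
  rintro ⟨⟨w, j⟩, ⟨i, a⟩⟩ ⟨⟨w', j'⟩, ⟨i', a'⟩⟩ h
  simp only [Prod.mk.injEq] at h
  obtain ⟨h1, ⟨h2, h3⟩, h4⟩ := h
  have h5 := canonEnd_injective R (Prod.ext h1 h2)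
  simp only [Prod.mk.injEq] at h5
  obtain ⟨h5, h6⟩ := h5
  rw [h5, h6, h3, h4]

/-- **The complex factor under a product law** (multilinearity of `cxWeight` in the vacancies of DISTINCT
ports): if the port coordinates `x` are occupied independently with probabilities `p x`, the expected
`acWc` — the product of the local factors at the vacancy INDICATORS — is the product of the local factors at
the vacancy PROBABILITIES of the coordinates the ends read. No hypothesis on the base: only the injectivity
of `(w, i, a, j) ↦ (port coordinate)`. -/
theorem sum_bw_acWc (R : RotGraph M 3) (lam : ℝ) (c : Fin M → ZMod 2)
    (p : Dart M 3 × ((Fin 2 × Fin κ) × ZMod 2) → ℝ) :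
    ∑ k : Dart M 3 → PortPat κ,
      (∏ x : Dart M 3 × ((Fin 2 × Fin κ) × ZMod 2), (if k x.1 x.2 then p x else 1 - p x)) * acWc R lam c k =
      ∏ q : Fin M × Fin κ, cxWeight (c q.1) lam fun l =>
        1 - p ((canonEnd R (q.1, l.1)).1, (((canonEnd R (q.1, l.1)).2, q.2), l.2)) := by
  -- families of port patterns as configurations of `(dart) × (port coordinate)`
  let e : (Dart M 3 → PortPat κ) ≃ Finset (Dart M 3 × ((Fin 2 × Fin κ) × ZMod 2)) :=
    { toFun := fun k => univ.filter fun x => k x.1 x.2 = true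
      invFun := fun t δ q => decide ((δ, q) ∈ t)
      left_inv := fun k => by
        funext δ q
        simp
      right_inv := fun t => by
        ext x
        simp }
  -- the used coordinates and the integrand as a function of the used occupied coordinates
  let ι : (Fin M × Fin κ) × (Fin 3 × ZMod 2) → Dart M 3 × ((Fin 2 × Fin κ) × ZMod 2) := fun u =>
    ((canonEnd R (u.1.1, u.2.1)).1, (((canonEnd R (u.1.1, u.2.1)).2, u.1.2), u.2.2))
  have hι : Function.Injective ι := usedCoord_injective R
  let G : Finset ((Fin M × Fin κ) × (Fin 3 × ZMod 2)) → ℝ := fun τ' =>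
    ∏ q : Fin M × Fin κ, cxWeight (c q.1) lam fun l => if (q, l) ∈ τ' then 0 else 1
  -- as a Bernoulli sum over configurations of `(dart) × (port coordinate)`
  have step1 : ∑ k : Dart M 3 → PortPat κ,
      (∏ x : Dart M 3 × ((Fin 2 × Fin κ) × ZMod 2), (if k x.1 x.2 then p x else 1 - p x)) * acWc R lam c k =
      ∑ t : Finset (Dart M 3 × ((Fin 2 × Fin κ) × ZMod 2)),
        ((∏ x ∈ t, p x) * ∏ x ∈ tᶜ, (1 - p x)) * G (univ.filter fun u => ι u ∈ t) := by
    refine Fintype.sum_equiv e _ _ fun k => ?_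
    have hmem : ∀ x : Dart M 3 × ((Fin 2 × Fin κ) × ZMod 2), x ∈ e k ↔ k x.1 x.2 = true :=
      fun x => by simp [e]
    have hfil : (univ.filter fun x : Dart M 3 × ((Fin 2 × Fin κ) × ZMod 2) => k x.1 x.2 = true) = e k := by
      ext x
      rw [hmem, mem_filter]
      simp
    congr 1
    · rw [prod_ite, ← compl_filter, hfil]
    · simp only [acWc, G, mem_filter, mem_univ, true_and, hmem, ι]
  rw [step1, sum_bw_marginal ι hι p G]
  -- complex by complex
  have hfun : ∀ τ' : Finset ((Fin M × Fin κ) × (Fin 3 × ZMod 2)), G τ' =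
      ∏ q : Fin M × Fin κ, cxWeight (c q.1) lam fun l =>
        if l ∈ (univ.filter fun l => (q, l) ∈ τ') then 0 else 1 := by
    intro τ'
    refine prod_congr rfl fun q _ => ?_
    congr 1
    funext l
    simp only [mem_filter, mem_univ, true_and]
  simp_rw [hfun]
  rw [sum_bw_prod_split (fun u => p (ι u)) (fun q s => cxWeight (c q.1) lam fun l => if l ∈ s then 0 else 1)]
  refine prod_congr rfl fun q _ => ?_
  have h1 := sum_bw_cxWeight (id : Fin 3 × ZMod 2 → Fin 3 × ZMod 2) Function.injective_id
    (fun l => p (ι (q, l))) (c q.1) lam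
  simp only [id] at h1
  exact h1

/-! ## The mixture weights and their expectation -/

/-- `NoFixed` (no half-edges): the gadget an end plugs into sits at a CANONICAL dart — `canonEnd R δ` is
`(δ, 0)` for canonical `δ` and `(R.rot δ, 1)` otherwise, and exactly one of `δ`, `R.rot δ ≠ δ` is canonical. -/
theorem canon_canonEnd_fst {R : RotGraph M 3} (hNF : NoFixed R) (δ : Dart M 3) : Canon R (canonEnd R δ).1 := by
  unfold canonEnd
  split_ifs with h
  · exact h
  · show Canon R (R.rot δ)
    unfold Canon at h ⊢
    rw [R.rot_rot]
    have hne : code (R.rot δ) ≠ code δ := fun e => hNF δ (code_injective e)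
    omega

/-- **Every substituted gadget factor is an average of two product laws over a phase bit.** The MIXTURE
weight substituted for `acGG δ` — `mixLaw k · gadTot` at a canonical dart (the main term of the annealed
port law), the junk factor `|GSample| · junkG k` itself otherwise — equals
`Σ_b ½ · mass_δ · Π_q (occupied ? p_δ(b, q) : 1 - p_δ(b, q))` with mass `gadTot` and law `layerOcc q⁺ q⁻ b`
at a canonical dart (`mixLaw` is by definition the average of the two `prodLaw`s), mass
`|GSample| (1+λ)^{2n'}` and the constant law `λ/(1+λ)` on the junk (`junkG_eq`). -/
theorem mid_eq_sum (R : RotGraph M 3) (P : Fin 2 × Fin κ ↪ Fin n') (τ : Equiv.Perm (Fin n')) (dm : ℕ)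
    {lam : ℝ} (hlam : 0 ≤ lam) (qp qm : ℝ) (δ : Dart M 3) (k : PortPat κ) :
    (if Canon R δ then mixLaw qp qm k * gadTot τ dm lam else ((GSample n' dm).card : ℝ) * junkG P lam k) =
      ∑ b : Bool, 1 / 2 * ((if Canon R δ then gadTot τ dm lam
          else ((GSample n' dm).card : ℝ) * (1 + lam) ^ Fintype.card (ZMod 2 × Fin n')) *
        ∏ q : (Fin 2 × Fin κ) × ZMod 2,
          (if k q then (if Canon R δ then layerOcc qp qm b q.2 else lam / (1 + lam))
            else 1 - (if Canon R δ then layerOcc qp qm b q.2 else lam / (1 + lam)))) := by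
  rw [Fintype.sum_bool]
  by_cases hC : Canon R δ
  · simp only [if_pos hC]
    unfold mixLaw prodLaw
    ring
  · simp only [if_neg hC]
    rw [junkG_eq P hlam k]
    ring

/-- The phases seen by a complex: the occupation probability of the port coordinate read by the end
`(w, i, a, j)` under the phases `Y` is `occP q⁺ q⁻ (seen R Y w (i, a))`. -/
theorem layerOcc_eq_occP_seen (R : RotGraph M 3) (qp qm : ℝ) (Y : Dart M 3 → Bool) (w : Fin M)
    (l : Fin 3 × ZMod 2) : layerOcc qp qm (Y (canonEnd R (w, l.1)).1) l.2 = occP qp qm (seen R Y w l) := rfl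

/-- **The product of the local factors at the seen phases** is `(1+λ)^{10 M κ} Π_w cxW(c w; seen Y w)^κ`. -/
theorem prod_cxWeight_seen (R : RotGraph M 3) {lam : ℝ} (hlam : 0 ≤ lam) (qp qm : ℝ) (c : Fin M → ZMod 2)
    (Y : Dart M 3 → Bool) :
    ∏ q : Fin M × Fin κ, cxWeight (c q.1) lam (fun l => 1 - occP qp qm (seen R Y q.1 l)) =
      (1 + lam) ^ (10 * M * κ) * ∏ w : Fin M, cxW lam qp qm (c w) (seen R Y w) ^ κ := by
  have hD : (0 : ℝ) < (1 + lam) ^ 10 := pow_pos (by linarith) 10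
  rw [Fintype.prod_prod_type]
  simp only [prod_const, card_univ, Fintype.card_fin]
  rw [show 10 * M * κ = (10 * κ) * M by ring, pow_mul,
    show ((1 + lam) ^ (10 * κ)) ^ M = ∏ _w : Fin M, (1 + lam) ^ (10 * κ) by
      rw [prod_const, card_univ, Fintype.card_fin], ← prod_mul_distrib]
  refine prod_congr rfl fun w _ => ?_
  rw [pow_mul, ← mul_pow]
  congr 1
  rw [cxW, mul_comm, div_mul_cancel₀ _ hD.ne']

/-- **The port computation of the annealed connector (Sly's Lemma 2.2, last displays, for the cover wiring).**
Expanding every substituted gadget factor over a phase bit (`mid_eq_sum`, `Fintype.prod_sum`), the pattern sum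
under each family of phases `Y : Dart → Bool` is the expectation of `acWc` under a product law on the port
coordinates, which `sum_bw_acWc` evaluates at the vacancy probabilities; by `NoFixed` every end reads a
canonical gadget, where the law is `layerOcc`, i.e. `occP (seen R Y w ·)`. Result:
`Σ_k (Π_δ mid_δ (k δ)) · acWc c k = C₁ · A_c` with the charge-independent constant
`C₁ = 2^{-3M} · Π_δ mass_δ · (1+λ)^{10 M κ}`. -/
theorem sum_prod_mid_mul_acWc {R : RotGraph M 3} (hNF : NoFixed R) (P : Fin 2 × Fin κ ↪ Fin n')
    (τ : Equiv.Perm (Fin n')) (dm : ℕ) {lam : ℝ} (hlam : 0 ≤ lam) (qp qm : ℝ) (c : Fin M → ZMod 2) :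
    ∑ k : Dart M 3 → PortPat κ, (∏ δ, (if Canon R δ then mixLaw qp qm (k δ) * gadTot τ dm lam
        else ((GSample n' dm).card : ℝ) * junkG P lam (k δ))) * acWc R lam c k =
      (1 / 2) ^ Fintype.card (Dart M 3) * (∏ δ : Dart M 3, (if Canon R δ then gadTot τ dm lam
        else ((GSample n' dm).card : ℝ) * (1 + lam) ^ Fintype.card (ZMod 2 × Fin n'))) *
        (1 + lam) ^ (10 * M * κ) * acA R lam qp qm κ c := by
  -- expand the mixtures: one phase bit per dart
  have hmix : ∀ k : Dart M 3 → PortPat κ, (∏ δ, (if Canon R δ then mixLaw qp qm (k δ) * gadTot τ dm lam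
        else ((GSample n' dm).card : ℝ) * junkG P lam (k δ))) =
      ∑ Y : Dart M 3 → Bool, (1 / 2) ^ Fintype.card (Dart M 3) * (∏ δ : Dart M 3, (if Canon R δ then
          gadTot τ dm lam else ((GSample n' dm).card : ℝ) * (1 + lam) ^ Fintype.card (ZMod 2 × Fin n'))) *
        ∏ x : Dart M 3 × ((Fin 2 × Fin κ) × ZMod 2),
          (if k x.1 x.2 then (if Canon R x.1 then layerOcc qp qm (Y x.1) x.2.2 else lam / (1 + lam))
            else 1 - (if Canon R x.1 then layerOcc qp qm (Y x.1) x.2.2 else lam / (1 + lam))) := by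
    intro k
    simp_rw [mid_eq_sum R P τ dm hlam]
    rw [Fintype.prod_sum]
    refine sum_congr rfl fun Y _ => ?_
    rw [prod_mul_distrib, prod_mul_distrib, prod_const, card_univ, ← Fintype.prod_prod_type']
    ring
  simp_rw [hmix, sum_mul]
  rw [sum_comm]
  simp_rw [mul_assoc, ← mul_sum, sum_bw_acWc]
  -- every end reads a canonical gadget (`NoFixed`), in phase `Y`
  have hocc : ∀ (Y : Dart M 3 → Bool) (q : Fin M × Fin κ) (l : Fin 3 × ZMod 2),
      (if Canon R (canonEnd R (q.1, l.1)).1 then layerOcc qp qm (Y (canonEnd R (q.1, l.1)).1)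
        (((canonEnd R (q.1, l.1)).2, q.2), l.2).2 else lam / (1 + lam)) = occP qp qm (seen R Y q.1 l) := by
    intro Y q l
    rw [if_pos (canon_canonEnd_fst hNF _)]
    exact layerOcc_eq_occP_seen R qp qm Y q.1 l
  simp_rw [hocc, prod_cxWeight_seen R hlam]
  rw [← mul_sum]
  unfold acA
  ring

end Summit.PneNP.PneNP.Cruxes.PolyDepthTwinsAbove.AnnealedCoverTwins
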